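import Literature.MathematicalPhysics.QuantumFieldTheory.Balaban1983to89.B8Thm4KLevelGammaRec

/-!
# `Balaban1983to89.B8Thm4KLevelGammaGRec` — [Balaban1985RegularSpaces] THEOREM 4 (p. 88), existence clause at the `k`-th level, edition γ, FOR THE RECORD's CENTRED
# AVERAGING ([Balaban1987RG1] (0.4)) **WITH THE GAUGE-GROUP INVARIANT `u x ∈ G`** ([Balaban1985Averaging] p. 20 «a Lie subgroup G of a unitary group U(N)»; print's case
# of record `G = SU(N)`): the `G`-form of `B8Thm4KLevelGammaRec.thm4_exists_all_levels_supp_landau138_γ`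

statement-level skeleton of published theorems with citation tags; proofs where landed; nothing here is a claim about the Yang–Mills mass gap

T. Bałaban, *Spaces of regular gauge field configurations on a lattice and gauge fixing conditions*, Commun. Math. Phys. **99** (1985) 75–102 `[Balaban1985RegularSpaces]`
("[6]"): Thm 4 p. 88, Prop. 3 p. 87, Prop. 5 (1.107)–(1.108) p. 94, (1.29) p. 81, (1.31) p. 82, (1.38) p. 82, (1.55)–(1.62) pp. 86–87, (1.66) p. 87, p. 76 («G = SU(N)»);
T. Bałaban, *Averaging operations for lattice gauge theories*, CMP **98** (1985) 17–51 `[Balaban1985Averaging]` ("[3]"): p. 20, Prop. 4 p. 38; T. Bałaban, *Renormalization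
group approach to lattice gauge field theories. I*, CMP **109** (1987) 249–301 `[Balaban1987RG1]` ("[I]"): (0.3)–(0.4) pp. 252–253.  STATUS: published, refereed.

CITATION HEADER (lean-in-tree rule).  Cell `pub-ymgap` (HUMAN RULING D-0062, Track A), «N05-REC» road (director-ym №254∕№255; LEAD PEN dag-n05-e), width seat
`pub-ymgap-dag-n07-w3` g12 (the N05-REC → K-road JUNCTION; ⚑ LOCATED-SU-AT-JUNCTION, cell bus 2026-08-29: the junction's premise `DatumCrownAt` ∕ `HThm4RecMember` row (vi)
are `SU(N)`-typed, the record crown as typed concludes `GaugedBoundB8DZ` with UNITARY `u`).  WHY THIS FILE.  The record Thm-4 induction driver is ALREADY `G`-general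
(`B8Thm4SupportLocalBdryRec.thm4_exists_all_levels_supp_bdry_mem`: `G ≤ U(𝔸)`, Prop. 5 sockets producing `G`-valued `v`, conclusion `u x ∈ G`); the `k`-th-level head
`B8Thm4KLevelGammaRec.thm4_exists_all_levels_supp_landau138_γ` specialises it to `G := U(𝔸)`.  THIS FILE is the SAME head over the `G`-general driver: statement byte for byte
dag-n05-e's, with `(G : Subgroup 𝔸ˣ) (hG : G ≤ unitaryUnits 𝔸)` added, the Prop. 5 sockets `hP5base` ∕ `hP5` read with `v x ∈ G` ∕ `u₁ x ∈ G`, and the conclusion `u x ∈ G`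
(Prop. 3's reset `hP3_gaugeFixed_of_b9_γ` and the (1.42) supplier are consumed BY NAME, unchanged — they quantify over unitary gauges, which `G`-valued ones are).  The engine
model is `B8Thm4AtLandau138G.thm4_exists_all_levels_landau138_mem` (dag-n05-e g33, pure cube).  Consumers: the `G`-forms of `B8Thm4ExistsAtGammaRec.thm4Exists_concrete_at_γ`
and of the crown root `B8Prop6DentedCubeMemberGammaRec.prop6_exists_dentedMember_at_γ₃`, then dag-n05-e's crown tail in its `G := SU(N)` edition (`SU(N)` is averaging-closed
for the record: `B7Prop2SpecialUnitaryRec.avgClosedZ_specialUnitary`, `N ≤ 12`).  Kind «kernel-checked proof», ONE theorem, one `exact`; no `def`, no `instance`, no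
`notation`, no existing module modified.  `--kind proof --supports stmt-QuantumFields-20541` (K0⁷-keyed, COUNT-NEUTRAL).

HONEST SCOPE: bookkeeping over landed theorems (the `G`-general driver + the unitary head's own suppliers); Propositions 3∕5 and [4] Thm 3.3 are NOT proved here (sockets
displayed); nothing of Bałaban's analysis re-proved; `HThm4Rec` UNDISCHARGED (caveat (C-S3-1)); N05 ∕ N07 NOT discharged; COUNT of record unmoved · K numerically unchanged;
one finite `𝕋⁴` programme at fixed `ε`, Bałaban AS PRINTED; nothing continuum ∕ ℝ⁴ ∕ OS ∕ mass-gap ∕ Clay.  No `sorry`, no `def`.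

[cite: Balaban1985RegularSpaces, Thm 4 p.88, Prop. 3 p.87, Prop. 5 (1.107)–(1.108) p.94, (1.55)–(1.62) pp.86–87, (1.31) p.82, (1.29) p.81, p.76; Balaban1985Averaging, p.20, Prop. 4 p.38; Balaban1987RG1, (0.3)–(0.4) pp.252–253]
-/

noncomputable section

open NormedSpace

namespace Literature.MathematicalPhysics.QuantumFieldTheory.Balaban1983to89.B8Thm4KLevelGammaGRec

open Complex (I I_ne_zero)
open MatrixLog B7Prop1Explicit B7Prop2Explicit B7Prop1Local B7Eq92Concrete
open B8Lemma1NonAbelian (mulCfg)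
open B8Ineq132 (covDerivFwd covDeriv covDiv plaqF InAk CondAt BondTouches PlaqTouches)
open B8Eq140Level (SideTouches)
open B8Eq119TwistedAxialRec (Restr129Z InAxZ)
open B8Eq184Proof (gaugeExp cfgExp)
open B8Eq146AExpansion (iEta expCfg)
open B7SectEFLinearisationRec (logCovIterZ linCovIterZ)
open BlockAveragingZd (avgIterZ ctrShift)
open B7Prop2Rec (AvgClosedZ C0Z avgClosedZ_unitaryUnits)
open B7Prop4GeneralLevelsRec (cZ gZ KZ)
open B8Lemma1NonAbelianRecLoops (halfVec)
open B8Eq155JBound (Jcur wsup)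
open B8ScaledSupNorm (bondNorm msup weight Bdd)
open B7Prop3Flat (c3)
open B7Eq78Linearization (conjR)
open B8Eq138LandauZdRec (IsLandau138WZ)
open B9SupplySockB9P3ZdBeta (CrossB)

-- `Site` alone could resolve to the torus sites of `Setup.lean`; re-export the `ℤ^d` sites of `B7Prop1Explicit`.
export B7Prop1Explicit (Site)

variable {d : ℕ}

variable {𝔸 : Type*} [CStarAlgebra 𝔸] [Nontrivial 𝔸]

/-! ## §1 Theorem 4 at the `k`-th level, edition γ, record structure, `G`-valued gauge transformations -/

/-- ★★★ **THEOREM 4's EXISTENCE CLAUSE AT THE `k`-TH LEVEL, EDITION γ, RECORD STRUCTURE, WITH THE INVARIANT `u x ∈ G`** — the `G`-form of dag-n05-e's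
`B8Thm4KLevelGammaRec.thm4_exists_all_levels_supp_landau138_γ`: for a subgroup `G ≤ U(𝔸)` ([3] p. 20, [6] p. 76 «G = SU(N)»), if Proposition 5's fixed point delivers
`G`-valued gauge transformations at the base level (`hP5base`) and at every step (`hP5`, for `G`-valued `u₁`), then the gauge transformation `u` of Theorem 4 at every level
`m ≤ k` is `G`-valued, `= 1` off `Ω₀`, (1.29)-normalised for the RECORD averages (`Restr129Z`), with `U₀^{…} = U′` in the record Landau gauge (1.38) (`IsLandau138WZ`) and the
exponential form with the (1.62)-letters.  Every other binder — Prop. 3's windows, [3] Prop. 4's windows one level lower, the box law, the class law, (1.33)∕(1.34)∕(1.35),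
(1.66)₀, the boundary-layer law, the β-shaped (1.59) body `H59Dβ` — is the unitary head's, byte for byte; Prop. 3's reset (`hP3_gaugeFixed_of_b9_γ`) and (1.42)
(`B8Eq142KLevelLocalGammaRec.H42_of_inAx_γ`) are consumed by name.
[cite: Balaban1985RegularSpaces, Thm 4 p.88, p.76 («G = SU(N)»), (1.29) p.81, (1.31) p.82, (1.38) p.82, (1.58)–(1.62) pp.86–87, (1.66) p.87, Prop. 5 (1.107)–(1.108) p.94; Balaban1985Averaging, p.20, Prop. 4 p.38; Balaban1987RG1, (0.3)–(0.4) pp.252–253] -/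
theorem thm4_exists_all_levels_supp_landau138_γ_mem (hd2 : 2 ≤ d) {η : ℝ} (hη : 0 < η) {L s : ℕ} (hLs : L = 2 * s + 1) (hs : 1 ≤ s) (k : ℕ)
    (G : Subgroup 𝔸ˣ) (hG : G ≤ unitaryUnits 𝔸)
    {U₀ U' : Site d → Fin d → 𝔸ˣ} (hU₀ : ∀ x κ, U₀ x κ ∈ unitaryUnits 𝔸) (hU' : ∀ x κ, U' x κ ∈ unitaryUnits 𝔸)
    {α₀ α₁ α₄ B₀ cstar a : ℝ} (hα₀ : 0 < α₀) (hα₁ : 0 < α₁) (hα₄ : 0 ≤ α₄) (hB₀ : 0 ≤ B₀)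
    (hc : cstar = 5 * d * L * B₀ * (α₀ + α₁))
    (hs₁ : α₄ ≤ 1 / 84) (hs₂ : L * cstar ≤ 1 / 12) (ha : a ≤ 1 / 4) (ha2 : 2 * a ≤ cstar)
    -- [3] Prop. 4's linearisation windows ONE LEVEL LOWER (edition γ)
    (hα3 : C0Z d * ((L : ℝ) ^ 2 * α₀) ≤ 1 / 3) (hα4 : 4 * ((L : ℝ) ^ 2 * α₀) ≤ c2' d L)
    (h16 : 16 * (2 * (L * cstar) + 8 * α₄) ≤ 1) (hd5 : 5 * (2 * (L * cstar) + 8 * α₄) * ((d : ℝ) - 1) ≤ 4)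
    (hsmall : Real.exp (4 * cZ d * ((L : ℝ) ^ 2 * α₀))
      * (1 + 2 * (131072 * ((d : ℝ) + 1) ^ 2) * (KZ d L) ^ 2 * ((L : ℝ) * (2 * (L * cstar) + 8 * α₄))) ≤ 2)
    (hc₃ : KZ d L * ((L : ℝ) * (2 * (L * cstar) + 8 * α₄)) ≤ c3 d L) (hside : 36 * d * B₀ * (2 * (L * cstar) + 8 * α₄) ≤ 1 / 2)
    (h50 : 50 * d * (2 * (L * cstar) + 8 * α₄) ≤ 1) (hsmall₁ : (d : ℝ) * L * α₁ ≤ 1 / 8)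
    {Bbd : ℝ} (hBbd : 0 ≤ Bbd) (ha0 : 0 ≤ a) (hbdry : 4 * Bbd * a ≤ ((d : ℝ) * L - 1) * B₀ * (α₀ + α₁))
    {C₂ : ℝ} (hC₂ : (1 + 2 * gZ d L) * (2 * (131072 * ((d : ℝ) + 1) ^ 2) * (KZ d L) ^ 2) * Real.exp (4 * cZ d * ((L : ℝ) ^ 2 * α₀)) * (L : ℝ) ^ 2 ≤ C₂)
    (h61 : 2 * (2 * (L * cstar) + 8 * α₄) ^ 2 + 20 * d * α₀ * (2 * (L * cstar) + 8 * α₄)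
      + 2 * C₂ * (2 * (L * cstar) + 8 * α₄) ^ 2 ≤ α₀ + α₁)
    (Ω : ℕ → Set (Site d)) (hΩ : ∀ j, Ω (j + 1) ⊆ Ω j) (Λs : ℕ → ℕ → Set (Site d)) (Λb : ℕ → ℕ → Set (Site d × Fin d))
    -- PRINT's box law (edition γ): the locality box of a level-`j` datum bond lies in `Ω_{j−1}` ((1.31); level 0: `Ω₀`)
    (hbox : ∀ m, m ≤ k → ∀ j, j ≤ m → ∀ c ∈ Λb m j, ∀ x, InBox (fun i => (L : ℤ) ^ j * c.1 i - (ctrShift L j : ℤ)) (fun i => (L : ℤ) ^ j * c.1 i + (ctrShift L j : ℤ) + if i = c.2 then (L : ℤ) ^ j else 0) x → x ∈ Ω (j - 1))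
    (hclass : ∀ m, m ≤ k → ∀ j, j ≤ m → ∀ c ∈ Λb m j,
      (c.1 ∈ Λs m j ∧ c.1 + e c.2 ∈ Λs m j) ∨
      (∃ j', j = j' + 1 ∧ (∀ x, (L : ℤ) • c.1 - halfVec L ≤ x → x ≤ (L : ℤ) • c.1 + halfVec L → x ∈ Λs m j') ∧ c.1 + e c.2 ∈ Λs m j) ∨
      (∃ j', j = j' + 1 ∧ c.1 ∈ Λs m j ∧ (∀ x, (L : ℤ) • (c.1 + e c.2) - halfVec L ≤ x → x ≤ (L : ℤ) • (c.1 + e c.2) + halfVec L → x ∈ Λs m j')))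
    (h33 : InAk L k η α₀ Ω U₀) (h34 : InAk L k η α₀ Ω (mulCfg U' U₀))
    (hAx : ∀ m, m ≤ k → InAxZ L m (Λs m) U₀ (mulCfg U' U₀))
    (h135 : ∀ j, j ≤ k → ∀ (z : Site d) (μ : Fin d), (∀ x, InBox (fun i => (L : ℤ) ^ j * z i - (ctrShift L j : ℤ)) (fun i => (L : ℤ) ^ j * z i + (ctrShift L j : ℤ) + if i = μ then (L : ℤ) ^ j else 0) x → x ∈ Ω (j - 1)) →
      ‖(avgIterZ L (mulCfg U' U₀) j z μ : 𝔸) - (avgIterZ L U₀ j z μ : 𝔸)‖ ≤ α₁)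
    (h66 : ∀ b ∈ {b : Site d × Fin d | SideTouches (Ω 0) b.1 b.2}, ‖((U' b.1 b.2 : 𝔸ˣ) : 𝔸) - 1‖ ≤ a)
    (hlay : ∀ m, 1 ≤ m → m ≤ k → ∀ y z : Site d, y ∈ Ω 0 → z ∉ Ω 0 → (∀ i, y i - 1 ≤ z i ∧ z i ≤ y i + 1) → y ∈ Λs m 0)
    (haα : a ≤ (d : ℝ) * L * α₁)
    (hP5base : ∃ (v : Site d → 𝔸ˣ) (lam : Site d → 𝔸), (∀ x, v x ∈ G) ∧ (∀ x, x ∉ Ω 0 → v x = 1) ∧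
        (∀ j, j ≤ 1 → ∀ b ∈ {b : Site d × Fin d | SideTouches (Ω j) b.1 b.2}, (v b.1 : 𝔸) = ((gaugeExp lam b.1 : 𝔸ˣ) : 𝔸) ∧
          (v (b.1 + e b.2) : 𝔸) = ((gaugeExp lam (b.1 + e b.2) : 𝔸ˣ) : 𝔸)) ∧
        (∀ j, j ≤ 1 → ∀ b ∈ {b : Site d × Fin d | SideTouches (Ω j) b.1 b.2},
          ‖lam b.1‖ ≤ α₄ ∧ ((L : ℝ) ^ j * η) * ‖covDerivFwd η U₀ b.2 lam b.1‖ ≤ α₄) ∧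
        IsLandau138WZ L 1 η (Ω 0) (Λs 1) U₀ (mgauge U₀ v⁻¹ U') ∧ Restr129Z L 1 (Λs 1) U₀ ((1 : Site d → 𝔸ˣ) * v))
    (hP5 : ∀ m, 1 ≤ m → m < k → ∀ (u₁ : Site d → 𝔸ˣ) (U₁ : Site d → Fin d → 𝔸ˣ) (A : Site d → Fin d → 𝔸),
      (∀ x, u₁ x ∈ G) → (∀ x, x ∉ Ω 0 → u₁ x = 1) → mgauge U₀ u₁ U₁ = U' → Restr129Z L m (Λs m) U₀ u₁ →
      IsLandau138WZ L m η (Ω 0) (Λs m) U₀ U₁ →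
      (∀ j, j ≤ m → ∀ b ∈ {b : Site d × Fin d | SideTouches (Ω j) b.1 b.2},
        U₁ b.1 b.2 = cfgExp η A b.1 b.2 ∧ IsSelfAdjoint (A b.1 b.2) ∧ ‖A b.1 b.2‖ ≤ cstar * ((L : ℝ) ^ j * η)⁻¹) →
      ∃ (v : Site d → 𝔸ˣ) (lam : Site d → 𝔸), (∀ x, v x ∈ G) ∧ (∀ x, x ∉ Ω 0 → v x = 1) ∧
        (∀ j, j ≤ m + 1 → ∀ b ∈ {b : Site d × Fin d | SideTouches (Ω j) b.1 b.2}, (v b.1 : 𝔸) = ((gaugeExp lam b.1 : 𝔸ˣ) : 𝔸) ∧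
          (v (b.1 + e b.2) : 𝔸) = ((gaugeExp lam (b.1 + e b.2) : 𝔸ˣ) : 𝔸)) ∧
        (∀ j, j ≤ m + 1 → ∀ b ∈ {b : Site d × Fin d | SideTouches (Ω j) b.1 b.2},
          ‖lam b.1‖ ≤ α₄ ∧ ((L : ℝ) ^ j * η) * ‖covDerivFwd η U₀ b.2 lam b.1‖ ≤ α₄) ∧
        IsLandau138WZ L (m + 1) η (Ω 0) (Λs (m + 1)) U₀ (mgauge U₀ v⁻¹ U₁) ∧ Restr129Z L (m + 1) (Λs (m + 1)) U₀ (u₁ * v))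
    (H59Dβ : ∀ m, 1 ≤ m → m ≤ k → ∀ (u : Site d → 𝔸ˣ) (W : Site d → Fin d → 𝔸ˣ) (A' : Site d → Fin d → 𝔸),
      (∀ x, u x ∈ unitaryUnits 𝔸) → (∀ x, x ∉ Ω 0 → u x = 1) → mgauge U₀ u W = U' → Restr129Z L m (Λs m) U₀ u →
      IsLandau138WZ L m η (Ω 0) (Λs m) U₀ W →
      (∀ y τ, IsSelfAdjoint (A' y τ)) →
      (∀ j, j ≤ m → ∀ y τ, SideTouches (Ω j) y τ →
        W y τ = cfgExp η A' y τ ∧ ‖A' y τ‖ ≤ (2 * (L * cstar) + 8 * α₄) * ((L : ℝ) ^ j * η)⁻¹) →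
      (∀ y τ, (∀ j, j ≤ m → ¬ SideTouches (Ω j) y τ) → A' y τ = 0) →
      msup L m η (-(1 : ℝ)) (fun j (b : Site d × Fin d) => SideTouches (Ω j) b.1 b.2) (fun b => A' b.1 b.2)
          ≤ B₀ * (bondNorm L m η (-(3 : ℝ)) Ω (fun x μ => Jcur η U₀ A' μ x)
            + wsup 1 (fun p : {p : ℕ × (Site d × Fin d) // p.1 ≤ m ∧ (p.2 ∈ Λb m p.1 ∨ (p.1 = 0 ∧ CrossB (Ω 0) p.2))} =>
                linCovIterZ L U₀ (iEta η A') p.1.1 p.1.2.1 p.1.2.2))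
            + Bbd * msup L m η (-(1 : ℝ)) (fun j (b : Site d × Fin d) => j = 0 ∧ SideTouches (Ω 0) b.1 b.2 ∧ ¬ BondTouches (Ω 0) b.1 b.2)
                (fun b => A' b.1 b.2) ∧
        msup L m η (-(2 : ℝ)) (fun j (t : Fin d × Fin d × Site d) => SideTouches (Ω j) t.2.2 t.2.1)
            (fun t => covDerivFwd η U₀ t.1 (fun z => A' z t.2.1) t.2.2)
          ≤ B₀ * (bondNorm L m η (-(3 : ℝ)) Ω (fun x μ => Jcur η U₀ A' μ x)
            + wsup 1 (fun p : {p : ℕ × (Site d × Fin d) // p.1 ≤ m ∧ (p.2 ∈ Λb m p.1 ∨ (p.1 = 0 ∧ CrossB (Ω 0) p.2))} =>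
                linCovIterZ L U₀ (iEta η A') p.1.1 p.1.2.1 p.1.2.2))
            + Bbd * msup L m η (-(1 : ℝ)) (fun j (b : Site d × Fin d) => j = 0 ∧ SideTouches (Ω 0) b.1 b.2 ∧ ¬ BondTouches (Ω 0) b.1 b.2)
                (fun b => A' b.1 b.2)) :
    ∀ m, m ≤ k → ∃ u : Site d → 𝔸ˣ, (∀ x, u x ∈ G) ∧ (∀ x, x ∉ Ω 0 → u x = 1) ∧ Restr129Z L m (Λs m) U₀ u ∧
      ∃ W : Site d → Fin d → 𝔸ˣ, mgauge U₀ u W = U' ∧ (1 ≤ m → IsLandau138WZ L m η (Ω 0) (Λs m) U₀ W) ∧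
        ∃ A : Site d → Fin d → 𝔸, ∀ j, j ≤ m → ∀ b ∈ {b : Site d × Fin d | SideTouches (Ω j) b.1 b.2},
          W b.1 b.2 = cfgExp η A b.1 b.2 ∧ IsSelfAdjoint (A b.1 b.2) ∧ ‖A b.1 b.2‖ ≤ cstar * ((L : ℝ) ^ j * η)⁻¹ := by
  have hL1 : 1 ≤ L := by omega
  have hcstar : 0 ≤ cstar := by rw [hc]; positivity
  have hα₂ : 0 ≤ 2 * (L * cstar) + 8 * α₄ := by positivity
  have hE : ∀ j, {b : Site d × Fin d | SideTouches (Ω (j + 1)) b.1 b.2} ⊆ {b : Site d × Fin d | SideTouches (Ω j) b.1 b.2} :=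
    fun j b hb => B8Eq140Level.sideTouches_mono (hΩ j) hb
  exact B8Thm4SupportLocalBdryRec.thm4_exists_all_levels_supp_bdry_mem hL1 hη (Ω 0) G hG hU₀ hU' hcstar hα₄ hs₁ hs₂ ha ha2
    (fun j => {b : Site d × Fin d | SideTouches (Ω j) b.1 b.2}) hE h66 Λs (fun m W => IsLandau138WZ L m η (Ω 0) (Λs m) U₀ W)
    hP5base hP5
    (B8Thm4KLevelGammaRec.hP3_gaugeFixed_of_b9_γ hd2 hη hLs hs k hU₀ hU' hα₀ hα₁.le hα₄ hB₀ hc hα3 hα4 h16 hd5 hsmall hc₃ hside h50 hC₂ h61 hBbd ha0 ha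
      hbdry Ω Λs Λb hbox h33 h34 h66 hlay haα (fun m W => IsLandau138WZ L m η (Ω 0) (Λs m) U₀ W)
      (B8Eq142KLevelLocalGammaRec.H42_of_inAx_γ hd2 hη hLs hs k hU₀ hα₀ hα₁ hα₂ hα3 hα4 hsmall hc₃ hsmall₁ Ω hΩ Λs Λb hbox hclass h33 h34
        hAx h135 (fun m W => IsLandau138WZ L m η (Ω 0) (Λs m) U₀ W))
      H59Dβ)


#print axioms thm4_exists_all_levels_supp_landau138_γ_mem

end Literature.MathematicalPhysics.QuantumFieldTheory.Balaban1983to89.B8Thm4KLevelGammaGRec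

end
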